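import Summits.QuantumFields.QCD.Theorems.SpectralDefectExtinctionTipPricingStubImsColdBoxes
import Summits.QuantumFields.QCD.Theorems.ExtinctionBuildsQCD.Negative.ExtinctIntegrable
import Literature.MathematicalPhysics.QuantumFieldTheory.QCDPhaseQuenched

/-!
# Helper `stub_coldBoxIntegrable` for stub `stub_coldBoxTail` of line `covariant-laplacian-floor`
(crux `Summit.QuantumFields.QCD.Theses.SpectralDefectExtinction.TipPricing`, item stmt-QuantumFields-8967)

**Integrability of the phase-quenched cold-box count** (the first conjunct of `stub_coldBoxTail`, for ALL
parameters).  For every number of flavours `Nf`, torus half-side `S`, radius `R`, threshold `E'`, coupling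
`β` and sea masses `b`, the integrand

  `U ↦ #{c ∈ {−S,…,S}⁴ : torusBox (2S+1) c R is E'-cold for U} · ∏_f |det D_W(U, b_f, 1)|`

is integrable against the Wilson measure `wilsonMeasure (fundamentalRep (Fin 3)) β` on `SU(3)` link fields of
the torus `(ℤ/(2S+1))⁴`.  Here a set of sites `B` is `E'`-cold for `U` iff some non-zero colour vector field
`v` supported in `B` has `Re⟨v, Lap_U v⟩ ≤ E' Σ_i |v i|²`, `Lap_U = Σ_μ (2 − F_μ − F_μᴴ)`, `F_μ = linkHop`.

**Proof.**  The cold event `{U | B is E'-cold for U}` is CLOSED (`coldInt_isClosed_cold`): by homogeneity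
the witness `v` may be taken on the unit sphere of the fields supported in `B`, a compact set `K`
(`coldInt_isCompact_sphere`; closed and bounded in a finite-dimensional space), and the event is the
projection along the compact factor `K` of the closed set `{(U, v) | Re⟨v, Lap_U v⟩ − E' ≤ 0}` (the form is
jointly continuous, `coldInt_continuous_form`; `isClosedMap_fst_of_compactSpace`).  Hence the count is a
finite sum of indicators of closed sets, so Borel measurable (`coldInt_measurable_count`), it is bounded by
`#box = (2S+1)⁴`, and a bounded measurable `ℕ`-valued functional times the continuous phase-quenched weight is
integrable against the (probability) Wilson measure (`integrable_natCount_mul_weight`, landed in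
`Theorems/ExtinctionBuildsQCD/Negative/ExtinctIntegrable.lean`).  Mathlib and tree facts only
(`linkHop`, `continuous_fundamentalRep`, `torusBox`, `box`, `card_box`, `wilsonMeasure`, `fermionDet`,
`wilsonDirac`); no named unproved facts.
-/

namespace Summit.QuantumFields.QCD.Cruxes.TipPricing.CovariantLaplacianFloor

open MeasureTheory Filter Matrix
open Literature.MathematicalPhysics.QuantumLattice Literature.MathematicalPhysics.QuantumFieldTheory
  Literature.Probability.LatticeModels
open Summit.QuantumFields.QCD.Theses.SpectralDefectExtinction
open scoped Classical

noncomputable section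

/-! ## Continuity of the covariant Laplacian and of its form -/

section General

variable {L : ℕ}

/-- The twisted shift `F_μ = linkHop` depends continuously on the gauge field. -/
theorem coldInt_continuous_linkHop (μ : Fin 4) :
    Continuous fun U : GaugeConfig 4 L SU3 => linkHop (fundamentalRep (Fin 3)) U μ := by
  refine continuous_pi fun p => continuous_pi fun q => ?_
  simp only [linkHop, Matrix.of_apply]
  split_ifs
  · exact ((continuous_fundamentalRep (Fin 3)).comp (continuous_apply (p.1, μ))).matrix_elem _ _
  · exact continuous_const

/-- The covariant Laplacian `Lap_U = Σ_μ (2 − F_μ − F_μᴴ)` depends continuously on the gauge field. -/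
theorem coldInt_continuous_lap :
    Continuous fun U : GaugeConfig 4 L SU3 =>
      ∑ μ : Fin 4, ((2 : ℂ) • (1 : Matrix (TorusSite 4 L × Fin 3) (TorusSite 4 L × Fin 3) ℂ)
        - linkHop (fundamentalRep (Fin 3)) U μ - (linkHop (fundamentalRep (Fin 3)) U μ)ᴴ) :=
  continuous_finsetSum _ fun μ _ =>
    (continuous_const.sub (coldInt_continuous_linkHop μ)).sub
      (coldInt_continuous_linkHop μ).matrix_conjTranspose

variable [NeZero L]

/-- The shifted Dirichlet form `(U, v) ↦ Re⟨v, Lap_U v⟩ − E' Σ_i |v i|²` is jointly continuous. -/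
theorem coldInt_continuous_form (E' : ℝ) :
    Continuous fun q : GaugeConfig 4 L SU3 × (TorusSite 4 L × Fin 3 → ℂ) =>
      (star q.2 ⬝ᵥ (∑ μ : Fin 4, ((2 : ℂ) • (1 : Matrix (TorusSite 4 L × Fin 3) (TorusSite 4 L × Fin 3) ℂ)
        - linkHop (fundamentalRep (Fin 3)) q.1 μ - (linkHop (fundamentalRep (Fin 3)) q.1 μ)ᴴ)) *ᵥ q.2).re
        - E' * ∑ i, ‖q.2 i‖ ^ 2 := by
  refine (Complex.continuous_re.comp ?_).sub (continuous_const.mul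
    (continuous_finsetSum _ fun i _ => ((continuous_apply i).comp continuous_snd).norm.pow 2))
  exact continuous_snd.star.dotProduct
    ((coldInt_continuous_lap.comp continuous_fst).matrix_mulVec continuous_snd)

end General

/-! ## Homogeneity of the form -/

section Scaling

variable {n : Type*} [Fintype n]

/-- `Re⟨r v, A (r v)⟩ = r² Re⟨v, A v⟩` for real `r`. -/
theorem coldInt_form_smul (A : Matrix n n ℂ) (r : ℝ) (v : n → ℂ) :
    (star ((r : ℂ) • v) ⬝ᵥ A *ᵥ ((r : ℂ) • v)).re = r ^ 2 * (star v ⬝ᵥ A *ᵥ v).re := by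
  rw [star_smul, mulVec_smul, smul_dotProduct, dotProduct_smul, Complex.star_def, Complex.conj_ofReal,
    smul_eq_mul, smul_eq_mul, ← mul_assoc, ← Complex.ofReal_mul, Complex.re_ofReal_mul]
  ring

/-- `Σ_i |r v i|² = r² Σ_i |v i|²` for real `r`. -/
theorem coldInt_normSq_smul (r : ℝ) (v : n → ℂ) :
    ∑ i, ‖((r : ℂ) • v) i‖ ^ 2 = r ^ 2 * ∑ i, ‖v i‖ ^ 2 := by
  rw [Finset.mul_sum]
  refine Finset.sum_congr rfl fun i _ => ?_
  rw [Pi.smul_apply, smul_eq_mul, norm_mul, Complex.norm_real, Real.norm_eq_abs, mul_pow, sq_abs]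

end Scaling

/-! ## The cold event is closed -/

section Closed

variable {L : ℕ} [NeZero L]

/-- The unit sphere of the colour vector fields supported in a set of sites `B` is compact. -/
theorem coldInt_isCompact_sphere (B : Finset (TorusSite 4 L)) :
    IsCompact {v : TorusSite 4 L × Fin 3 → ℂ |
      (∀ p : TorusSite 4 L × Fin 3, p.1 ∉ B → v p = 0) ∧ ∑ i, ‖v i‖ ^ 2 = 1} := by
  apply Metric.isCompact_of_isClosed_isBounded
  · rw [Set.setOf_and]
    refine IsClosed.inter ?_ ?_
    · rw [Set.setOf_forall]
      refine isClosed_iInter fun p => ?_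
      by_cases hp : p.1 ∈ B
      · simp [hp]
      · simp only [hp, not_false_eq_true, forall_const]
        exact isClosed_eq (continuous_apply p) continuous_const
    · exact isClosed_eq (continuous_finsetSum _ fun i _ => (continuous_apply i).norm.pow 2)
        continuous_const
  · rw [Metric.isBounded_iff_subset_closedBall 0]
    refine ⟨1, fun v hv => ?_⟩
    rw [Metric.mem_closedBall, dist_zero_right, pi_norm_le_iff_of_nonneg zero_le_one]
    intro i
    have h1 : ‖v i‖ ^ 2 ≤ 1 :=
      hv.2 ▸ Finset.single_le_sum (f := fun j => ‖v j‖ ^ 2) (fun j _ => sq_nonneg _) (Finset.mem_univ i)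
    nlinarith [norm_nonneg (v i)]

/-- **The cold event is closed.**  For every set of sites `B` and threshold `E'`, the set of gauge fields `U`
for which some non-zero colour field supported in `B` has `Re⟨v, Lap_U v⟩ ≤ E' Σ|v i|²` is closed: it is
the projection along the compact unit sphere of supported fields of a closed set. -/
theorem coldInt_isClosed_cold (B : Finset (TorusSite 4 L)) (E' : ℝ) :
    IsClosed {U : GaugeConfig 4 L SU3 | ∃ v : TorusSite 4 L × Fin 3 → ℂ, v ≠ 0 ∧
      (∀ p : TorusSite 4 L × Fin 3, p.1 ∉ B → v p = 0) ∧
      (star v ⬝ᵥ (∑ μ : Fin 4, ((2 : ℂ) • (1 : Matrix (TorusSite 4 L × Fin 3) (TorusSite 4 L × Fin 3) ℂ)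
        - linkHop (fundamentalRep (Fin 3)) U μ - (linkHop (fundamentalRep (Fin 3)) U μ)ᴴ)) *ᵥ v).re
        ≤ E' * ∑ i, ‖v i‖ ^ 2} := by
  set K : Set (TorusSite 4 L × Fin 3 → ℂ) := {v |
    (∀ p : TorusSite 4 L × Fin 3, p.1 ∉ B → v p = 0) ∧ ∑ i, ‖v i‖ ^ 2 = 1} with hKdef
  have hK : IsCompact K := coldInt_isCompact_sphere B
  haveI : CompactSpace K := isCompact_iff_compactSpace.mp hK
  -- the shifted form, jointly continuous
  set Φ : GaugeConfig 4 L SU3 × (TorusSite 4 L × Fin 3 → ℂ) → ℝ := fun q =>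
    (star q.2 ⬝ᵥ (∑ μ : Fin 4, ((2 : ℂ) • (1 : Matrix (TorusSite 4 L × Fin 3) (TorusSite 4 L × Fin 3) ℂ)
      - linkHop (fundamentalRep (Fin 3)) q.1 μ - (linkHop (fundamentalRep (Fin 3)) q.1 μ)ᴴ)) *ᵥ q.2).re
      - E' * ∑ i, ‖q.2 i‖ ^ 2 with hΦdef
  have hΦ : Continuous Φ := coldInt_continuous_form E'
  set F : Set (GaugeConfig 4 L SU3 × K) := {q | Φ (q.1, (q.2 : TorusSite 4 L × Fin 3 → ℂ)) ≤ 0} with hFdef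
  have hF : IsClosed F :=
    isClosed_le (hΦ.comp (continuous_fst.prodMk (continuous_subtype_val.comp continuous_snd)))
      continuous_const
  have himage : {U : GaugeConfig 4 L SU3 | ∃ v : TorusSite 4 L × Fin 3 → ℂ, v ≠ 0 ∧
      (∀ p : TorusSite 4 L × Fin 3, p.1 ∉ B → v p = 0) ∧
      (star v ⬝ᵥ (∑ μ : Fin 4, ((2 : ℂ) • (1 : Matrix (TorusSite 4 L × Fin 3) (TorusSite 4 L × Fin 3) ℂ)
        - linkHop (fundamentalRep (Fin 3)) U μ - (linkHop (fundamentalRep (Fin 3)) U μ)ᴴ)) *ᵥ v).re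
        ≤ E' * ∑ i, ‖v i‖ ^ 2} = Prod.fst '' F := by
    ext U
    simp only [Set.mem_setOf_eq, Set.mem_image, Prod.exists, Subtype.exists, exists_and_right,
      exists_eq_right]
    constructor
    · rintro ⟨v, hv0, hsupp, hle⟩
      -- normalise the witness
      have hpos : 0 < ∑ i, ‖v i‖ ^ 2 := by
        obtain ⟨i, hi⟩ : ∃ i, v i ≠ 0 := by
          by_contra hall
          push Not at hall
          exact hv0 (funext hall)
        exact lt_of_lt_of_le (by positivity : 0 < ‖v i‖ ^ 2)
          (Finset.single_le_sum (f := fun i => ‖v i‖ ^ 2) (fun i _ => sq_nonneg _) (Finset.mem_univ i))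
      set r : ℝ := Real.sqrt (∑ i, ‖v i‖ ^ 2) with hr
      have hr0 : 0 < r := Real.sqrt_pos.mpr hpos
      have hr2 : r ^ 2 = ∑ i, ‖v i‖ ^ 2 := Real.sq_sqrt hpos.le
      have hrr : r⁻¹ ^ 2 * ∑ i, ‖v i‖ ^ 2 = 1 := by
        rw [← hr2, inv_pow, inv_mul_cancel₀ (pow_ne_zero 2 hr0.ne')]
      set w : TorusSite 4 L × Fin 3 → ℂ := ((r⁻¹ : ℝ) : ℂ) • v with hw
      have hwK : w ∈ K := by
        refine ⟨fun p hp => ?_, ?_⟩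
        · simp [hw, hsupp p hp]
        · rw [hw, coldInt_normSq_smul, hrr]
      refine ⟨w, hwK, ?_⟩
      show Φ (U, w) ≤ 0
      simp only [hΦdef, hw]
      rw [coldInt_form_smul, coldInt_normSq_smul, hrr, mul_one]
      have h := mul_le_mul_of_nonneg_left hle (sq_nonneg r⁻¹)
      rw [← mul_assoc, mul_comm (r⁻¹ ^ 2) E', mul_assoc, hrr, mul_one] at h
      linarith
    · rintro ⟨w, hwK, hle⟩
      change Φ (U, w) ≤ 0 at hle
      simp only [hΦdef] at hle
      refine ⟨w, fun h0 => ?_, hwK.1, ?_⟩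
      · have := hwK.2
        rw [h0] at this
        simp at this
      · rw [hwK.2, mul_one] at hle ⊢
        linarith
  rw [himage]
  exact isClosedMap_fst_of_compactSpace _ hF

end Closed

/-! ## Measurability of the count and integrability -/

/-- **The cold-box count is Borel measurable in the gauge field** (a finite sum of indicators of closed
sets). -/
theorem coldInt_measurable_count (S R : ℕ) (E' : ℝ) :
    Measurable fun U : GaugeConfig 4 (2 * S + 1) SU3 =>
      ((box 4 S).filter fun c : Site 4 =>
        ∃ v : TorusSite 4 (2 * S + 1) × Fin 3 → ℂ, v ≠ 0 ∧
          (∀ p : TorusSite 4 (2 * S + 1) × Fin 3, p.1 ∉ torusBox (2 * S + 1) c R → v p = 0) ∧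
          (star v ⬝ᵥ (∑ μ : Fin 4, ((2 : ℂ) • (1 : Matrix (TorusSite 4 (2 * S + 1) × Fin 3)
              (TorusSite 4 (2 * S + 1) × Fin 3) ℂ)
            - linkHop (fundamentalRep (Fin 3)) U μ
            - (linkHop (fundamentalRep (Fin 3)) U μ)ᴴ)) *ᵥ v).re
            ≤ E' * ∑ i, ‖v i‖ ^ 2).card := by
  simp only [Finset.card_filter]
  refine Finset.measurable_sum _ fun c _ => Measurable.ite ?_ measurable_const measurable_const
  exact (coldInt_isClosed_cold (torusBox (2 * S + 1) c R) E').measurableSet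

/-- **Integrability of the weighted cold-box count** (helper for stub `stub_coldBoxTail` of line
`covariant-laplacian-floor`; its first conjunct, for all parameters).  For all `Nf S R E' β b`, the number of
`E'`-cold boxes of radius `R` centred in `{−S,…,S}⁴` times the phase-quenched weight `∏_f |det D_W(U,b_f,1)|`
is integrable against the Wilson measure at coupling `β` on the torus of side `2S+1`: the count is Borel
measurable (indicators of closed events) and bounded by `(2S+1)⁴`, the weight is continuous on the compact
configuration space, the Wilson measure is a probability measure. -/
theorem stub_coldBoxIntegrable :
    ∀ (Nf S R : ℕ) (E' β : ℝ) (b : Fin Nf → ℝ),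
        Integrable (fun U : GaugeConfig 4 (2 * S + 1) SU3 =>
            (((box 4 S).filter fun c : Site 4 =>
              ∃ v : TorusSite 4 (2 * S + 1) × Fin 3 → ℂ, v ≠ 0 ∧
                (∀ p : TorusSite 4 (2 * S + 1) × Fin 3, p.1 ∉ torusBox (2 * S + 1) c R → v p = 0) ∧
                (star v ⬝ᵥ (∑ μ : Fin 4, ((2 : ℂ) • (1 : Matrix (TorusSite 4 (2 * S + 1) × Fin 3)
                    (TorusSite 4 (2 * S + 1) × Fin 3) ℂ)
                  - linkHop (fundamentalRep (Fin 3)) U μ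
                  - (linkHop (fundamentalRep (Fin 3)) U μ)ᴴ)) *ᵥ v).re
                  ≤ E' * ∑ i, ‖v i‖ ^ 2).card : ℝ) *
              ∏ f : Fin Nf, ‖fermionDet (wilsonDirac (fundamentalRep (Fin 3)) U (b f) 1)‖)
          (wilsonMeasure (d := 4) (L := 2 * S + 1) (fundamentalRep (Fin 3)) β) := by
  intro Nf S R E' β b
  refine Theorems.ExtinctionBuildsQCD.Negative.integrable_natCount_mul_weight b β
    (coldInt_measurable_count S R E') (N := (2 * S + 1) ^ 4) fun U => ?_
  exact (Finset.card_filter_le _ _).trans (card_box 4 S).le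

end

end Summit.QuantumFields.QCD.Cruxes.TipPricing.CovariantLaplacianFloor
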